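import Literature.AlgebraicGeometry.GroupSchemes.CartierDualCharacterPoints
import Literature.AlgebraicGeometry.GroupSchemes.AffineGroupSchemeIsoSpec
import Literature.AlgebraicGeometry.GroupSchemes.MultiplicativeGroupSchemeDet
import HarnessLib

/-!
# Characters on points are points of the Cartier dual — `G^D(S) = Hom_{S-gr}(G_S, 𝔾_{m,S})` in Yoneda form (Tate 1997 §(3.8) — part 2)

Layer `Literature/AlgebraicGeometry/GroupSchemes`, namespace `Literature.AlgebraicGeometry.GroupSchemes.AffineGroupScheme` (§0 in
`Literature.AlgebraicGeometry.GroupSchemes`); continues part 1 ★ `CartierDualCharacterPoints` (the canonical pairing `⟪t, x⟫`, separation,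
adjunction), ★ `AffineGroupSchemeIsoSpec` (`isAffine_tensorObj_left`) and ★ `MultiplicativeGroupSchemeDet` §0 (`isMonHom_of_points`, GW Def. 4.42).
DEFINITIONS (the test maps `testMapLeft ∕ Right ∕ Mul`, the contraction `contractTwo`) + theorems; no instance, no notation, no named fact, no
`sorry`, no heartbeat budget.  Cell `hodgecm-mathlib` (D-0151), programme P6 «MOD» (crux item stmt-HodgeConjecture-24832, `--supports`), organ
(σ1-a) ∕ (W1-DOCK) for the W-line `F0_P6b_WeilCartierDuality`, stub `stub_W1` (LEAD F0P6-plan (g2) M-17v (3): «the Yoneda form is preferred —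
no Hopf algebra in the W1 hand»; B-p08 (g32) interface note 20:17:08Z: the geometric character family is available on locally Noetherian test
schemes only, whence the FINITE-test-ring form `…_of_finite`).  Count-neutral: HC_CM is proved only modulo the printed citations until rung 0
closes; nothing here is about HC.

THE PRINT ([Tate1997FiniteFlatGroupSchemes] §(3.8) p. 145 «`G^D(S) = Hom_{S-gr}(G_S, 𝔾_{m,S})`»; [MumfordAV1970] §20 p. 184, §15 Thm. 1).  For a
commutative affine group object `G` of `SchemeOver R` with `A := Γ(G, 𝒪_G)` finite free:
* §0 `isMonHom_of_universal_pair` — a morphism `M → N` into a GROUP object is a homomorphism as soon as it is multiplicative on the universal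
  pair of points `pr₁, pr₂ : M × M → M` (any cartesian monoidal category);
* §1 test points over `S ⊗ A` and `S ⊗ (A ⊗ A)`: the coordinate points `Spec θ₁ ≫ x_univ`, `Spec θ₂ ≫ x_univ` MULTIPLY to `Spec (1 ⊗ Δ) ≫ x_univ`
  (`specOverMap_testMapLeft_mul_specOverMap_testMapRight`), and `Spec (ev_1) ≫ x_univ = 1`;
* §2 **`exists_point_cartierDual_of_character_of`** — over a FIXED test ring `S`, with test rings restricted to any class `P ∋ S, S ⊗ A,
  S ⊗ (A ⊗ A)`: a family `χ_ψ(x) ∈ T` (`ψ : S → T` in `P`, `x ∈ G(T)`), natural, multiplicative and unital in `x`, is `⟪Spec ψ ≫ t, x⟫` for a point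
  `t ∈ G^D(S)` — `g := χ(x_univ) ∈ S ⊗ A` is GROUP-LIKE (`Φ g (F ⋆ F′) = Φ g F · Φ g F′` from multiplicativity on the universal pair,
  `charPairing_convMul` ∕ `charPairing_mul_charPairing`; ★ CD2-pts `isGroupLikeElem_of_map_convMul`); `point_cartierDual_ext_of` (uniqueness);
Part 3 (`CartierDualCharacterYonedaHom`): THE YONEDA FORM for an affine group object `Y` — a natural family `χ(y, x)`, bimultiplicative and
unital, is `⟪y ≫ w, x⟫` for a unique HOMOMORPHISM `w : Y ⟶ G^D` (all test rings, or finite ones when `Y`, `G` are finite) — and how the W1 hand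
uses it.

## References
* [Tate1997FiniteFlatGroupSchemes] J. Tate, *Finite flat group schemes*, in: Modular Forms and Fermat's Last Theorem (1997), §(3.8) p. 145.
* [MumfordAV1970] D. Mumford, *Abelian Varieties* (1970), §15 Thm. 1 (p. 143), §20 pp. 183–185.
* [Montgomery1993Hopf] S. Montgomery, *Hopf Algebras and Their Actions on Rings*, CBMS 82 (1993), 1.3.5, 9.1.4.
* [GortzWedhorn2020] U. Görtz, T. Wedhorn, *Algebraic Geometry I* (2nd ed. 2020), Definition 4.42 (p. 116).
* [GortzWedhorn2023] U. Görtz, T. Wedhorn, *Algebraic Geometry II* (2023), §(27.2), (27.2.1) (pp. 606–607).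
-/

set_option autoImplicit false

-- Mathlib's `Over`/`Scheme` APIs (and the tree's `DualAlg G := WithConv (Dual R (Alg G))`) are used across semireducible wrappers (as in the ★
-- `GroupSchemes/*` files).
set_option backward.isDefEq.respectTransparency false

universe u

open CategoryTheory CategoryTheory.Limits AlgebraicGeometry MonoidalCategory CartesianMonoidalCategory TensorProduct WithConv

noncomputable section

namespace Literature.AlgebraicGeometry.GroupSchemes

/-! ## §0 A morphism into a group object is a homomorphism iff it is multiplicative on the universal pair of points -/

section Universal

variable {C : Type*} [Category C] [CartesianMonoidalCategory C] {M N : C} [MonObj M] [GrpObj N]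

open scoped MonObj in
/-- **Homomorphisms are tested on the UNIVERSAL pair of points** `pr₁, pr₂ : M × M → M`: a morphism `f : M → N` into a GROUP object with
`f ∘ (pr₁ · pr₂) = (f ∘ pr₁) · (f ∘ pr₂)` is a homomorphism (every pair of `T`-points `(a, b)` factors through `(pr₁, pr₂)` along `⟨a, b⟩`;
the unit law follows in the group `N(T)` from `f(1) = f(1 · 1) = f(1) f(1)`; ★ `isMonHom_of_points`, [GortzWedhorn2020] Def. 4.42).
[cite: GortzWedhorn2020, Definition 4.42, p. 116] -/
theorem isMonHom_of_universal_pair (f : M ⟶ N) (h : (fst M M * snd M M) ≫ f = (fst M M ≫ f) * (snd M M ≫ f)) : IsMonHom f := by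
  have hmul : ∀ ⦃T : C⦄ (a b : T ⟶ M), (a * b) ≫ f = (a ≫ f) * (b ≫ f) := by
    intro T a b
    have hab : a * b = lift a b ≫ (fst M M * snd M M) := by
      rw [Hom.mul_def, Hom.mul_def, lift_fst_snd, Category.id_comp]
    rw [hab, Category.assoc, h, MonObj.comp_mul, lift_fst_assoc, lift_snd_assoc]
  refine isMonHom_of_points f (fun T => ?_) hmul
  have h1 : ((1 : T ⟶ M) ≫ f) * ((1 : T ⟶ M) ≫ f) = (1 : T ⟶ M) ≫ f := by rw [← hmul, mul_one]
  exact mul_eq_left.mp h1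

end Universal

namespace AffineGroupScheme

open scoped MonObj

open Literature.AlgebraicGeometry.Motives Literature.NumberTheory.DiophantineGeometry Literature.RingTheory.HopfAlgebra

variable {R : Type u} [CommRing R]

variable (G : SchemeOver R) [GrpObj G] [IsCommMonObj G] [IsAffine G.left] [Module.Free R (Alg G)] [Module.Finite R (Alg G)]

/-! ## §1 Points of `G` over `S ⊗ Γ(G)` and `S ⊗ (Γ(G) ⊗ Γ(G))`: the tautological point, the two coordinate points, their product -/

section TestPoints

variable (S : Type u) [CommRing S] [Algebra R S]

/-- The test map `θ₁ = 1 ⊗ ι₁ : S ⊗ A → S ⊗ (A ⊗ A)`, `s ⊗ a ↦ s ⊗ (a ⊗ 1)` (`A = Γ(G, 𝒪_G)`). [cite: Tate1997FiniteFlatGroupSchemes, §(3.8) p. 145] -/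
def testMapLeft : S ⊗[R] Alg G →ₐ[R] S ⊗[R] (Alg G ⊗[R] Alg G) :=
  Algebra.TensorProduct.map (AlgHom.id R S) (Algebra.TensorProduct.includeLeft : Alg G →ₐ[R] Alg G ⊗[R] Alg G)

/-- The test map `θ₂ = 1 ⊗ ι₂ : S ⊗ A → S ⊗ (A ⊗ A)`, `s ⊗ a ↦ s ⊗ (1 ⊗ a)`. [cite: Tate1997FiniteFlatGroupSchemes, §(3.8) p. 145] -/
def testMapRight : S ⊗[R] Alg G →ₐ[R] S ⊗[R] (Alg G ⊗[R] Alg G) :=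
  Algebra.TensorProduct.map (AlgHom.id R S) (Algebra.TensorProduct.includeRight : Alg G →ₐ[R] Alg G ⊗[R] Alg G)

/-- The test map `θ₁₂ = 1 ⊗ Δ : S ⊗ A → S ⊗ (A ⊗ A)`, `s ⊗ a ↦ s ⊗ Δ(a)`. [cite: Tate1997FiniteFlatGroupSchemes, §(3.8) p. 145] -/
def testMapMul : S ⊗[R] Alg G →ₐ[R] S ⊗[R] (Alg G ⊗[R] Alg G) :=
  Algebra.TensorProduct.map (AlgHom.id R S) (Bialgebra.comulAlgHom R (Alg G))

omit [GrpObj G] [IsCommMonObj G] [IsAffine G.left] [Module.Free R (Alg G)] [Module.Finite R (Alg G)] in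
/-- `θ₁ (s ⊗ a) = s ⊗ (a ⊗ 1)`. [cite: Tate1997FiniteFlatGroupSchemes, §(3.8) p. 145] -/
@[simp] theorem testMapLeft_tmul (s : S) (a : Alg G) : testMapLeft G S (s ⊗ₜ a) = s ⊗ₜ (a ⊗ₜ 1) := by
  simp [testMapLeft]

omit [GrpObj G] [IsCommMonObj G] [IsAffine G.left] [Module.Free R (Alg G)] [Module.Finite R (Alg G)] in
/-- `θ₂ (s ⊗ a) = s ⊗ (1 ⊗ a)`. [cite: Tate1997FiniteFlatGroupSchemes, §(3.8) p. 145] -/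
@[simp] theorem testMapRight_tmul (s : S) (a : Alg G) : testMapRight G S (s ⊗ₜ a) = s ⊗ₜ (1 ⊗ₜ a) := by
  simp [testMapRight]

omit [IsCommMonObj G] [Module.Free R (Alg G)] [Module.Finite R (Alg G)] in
/-- `θ₁₂ (s ⊗ a) = s ⊗ Δ(a)`. [cite: Tate1997FiniteFlatGroupSchemes, §(3.8) p. 145] -/
@[simp] theorem testMapMul_tmul (s : S) (a : Alg G) : testMapMul G S (s ⊗ₜ a) = s ⊗ₜ Coalgebra.comul (R := R) a := by
  simp [testMapMul]

omit [GrpObj G] [IsCommMonObj G] [IsAffine G.left] [Module.Free R (Alg G)] [Module.Finite R (Alg G)] in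
/-- `θ₁ ∘ (s ↦ s ⊗ 1) = (s ↦ s ⊗ 1)`. [cite: Tate1997FiniteFlatGroupSchemes, §(3.8) p. 145] -/
theorem testMapLeft_comp_includeLeft :
    (testMapLeft G S).comp (Algebra.TensorProduct.includeLeft : S →ₐ[R] S ⊗[R] Alg G) = Algebra.TensorProduct.includeLeft := by
  ext s; simp [testMapLeft]

omit [GrpObj G] [IsCommMonObj G] [IsAffine G.left] [Module.Free R (Alg G)] [Module.Finite R (Alg G)] in
/-- `θ₂ ∘ (s ↦ s ⊗ 1) = (s ↦ s ⊗ 1)`. [cite: Tate1997FiniteFlatGroupSchemes, §(3.8) p. 145] -/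
theorem testMapRight_comp_includeLeft :
    (testMapRight G S).comp (Algebra.TensorProduct.includeLeft : S →ₐ[R] S ⊗[R] Alg G) = Algebra.TensorProduct.includeLeft := by
  ext s; simp [testMapRight]

omit [IsCommMonObj G] [Module.Free R (Alg G)] [Module.Finite R (Alg G)] in
/-- `θ₁₂ ∘ (s ↦ s ⊗ 1) = (s ↦ s ⊗ 1)`. [cite: Tate1997FiniteFlatGroupSchemes, §(3.8) p. 145] -/
theorem testMapMul_comp_includeLeft :
    (testMapMul G S).comp (Algebra.TensorProduct.includeLeft : S →ₐ[R] S ⊗[R] Alg G) = Algebra.TensorProduct.includeLeft := by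
  ext s; simp [testMapMul]

omit [IsCommMonObj G] [Module.Free R (Alg G)] [Module.Finite R (Alg G)] in
/-- **The product of the two coordinate points is the comultiplication point**: over `S ⊗ (A ⊗ A)`,
`(Spec θ₁ ≫ x_univ) · (Spec θ₂ ≫ x_univ) = Spec θ₁₂ ≫ x_univ` — the algebra map of the product is the convolution `a ↦ ∑ (1 ⊗ lᵢ ⊗ 1)(1 ⊗ 1 ⊗ rᵢ)
= 1 ⊗ Δ(a)` (★ `ptEquiv_mul_apply`). [cite: GortzWedhorn2023, §(27.2) (27.2.1) (pp. 606–607)] -/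
theorem specOverMap_testMapLeft_mul_specOverMap_testMapRight :
    (AlgPoints.specOverMapOfAlgHom (testMapLeft G S) ≫ tautPt G S) * (AlgPoints.specOverMapOfAlgHom (testMapRight G S) ≫ tautPt G S) =
      AlgPoints.specOverMapOfAlgHom (testMapMul G S) ≫ tautPt G S := by
  apply (ptEquiv G (S ⊗[R] (Alg G ⊗[R] Alg G))).injective
  apply AlgHom.ext
  intro a
  let 𝓡 := Coalgebra.Repr.arbitrary R a
  rw [ptEquiv_mul_apply G _ _ a 𝓡, ptEquiv_comap, ptEquiv_comap, ptEquiv_comap, ptEquiv_tautPt, AlgHom.comp_apply,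
    Algebra.TensorProduct.includeRight_apply, testMapMul_tmul, ← 𝓡.eq, TensorProduct.tmul_sum]
  refine Finset.sum_congr rfl fun i _ => ?_
  rw [AlgHom.comp_apply, AlgHom.comp_apply, Algebra.TensorProduct.includeRight_apply, Algebra.TensorProduct.includeRight_apply,
    testMapLeft_tmul, testMapRight_tmul, Algebra.TensorProduct.tmul_mul_tmul, one_mul, Algebra.TensorProduct.tmul_mul_tmul, one_mul, mul_one]

omit [Module.Free R (Alg G)] [Module.Finite R (Alg G)] in
/-- **The unit point over `S` through the tautological point**: `Spec (ev_1) ≫ x_univ = 1`, where `ev_1 = 1 ⊗ ε : S ⊗ A → S`.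
[cite: GortzWedhorn2023, §(27.2) (27.2.1) (pp. 606–607)] -/
theorem specOverMap_evalAt_one_comp_tautPt :
    AlgPoints.specOverMapOfAlgHom ((evalAt G (1 : specOver R S ⟶ G)).restrictScalars R) ≫ tautPt G S = 1 := by
  apply (ptEquiv G S).injective
  rw [ptEquiv_comap, ptEquiv_tautPt]
  apply AlgHom.ext
  intro a
  rw [AlgHom.comp_apply, Algebra.TensorProduct.includeRight_apply, AlgHom.restrictScalars_apply, evalAt_tmul, one_mul]

omit [Module.Free R (Alg G)] [Module.Finite R (Alg G)] in
/-- `ev_1 ∘ (s ↦ s ⊗ 1) = id_S`. [cite: GortzWedhorn2023, §(27.2) (27.2.1) (pp. 606–607)] -/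
theorem evalAt_one_comp_includeLeft :
    ((evalAt G (1 : specOver R S ⟶ G)).restrictScalars R).comp (Algebra.TensorProduct.includeLeft : S →ₐ[R] S ⊗[R] Alg G) =
      AlgHom.id R S := by
  apply AlgHom.ext
  intro s
  rw [AlgHom.comp_apply, Algebra.TensorProduct.includeLeft_apply, AlgHom.restrictScalars_apply, evalAt_tmul, map_one, mul_one,
    AlgHom.id_apply]

end TestPoints

/-! ## §2 EXISTENCE over a fixed test ring `S`: a natural multiplicative character on points is a (unique) point of `G^D` -/

section FixedRing

variable {S : Type u} [CommRing S] [Algebra R S]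

/-- **Contraction with two functionals**: `c_{F,F′} : S ⊗ (A ⊗ A) → S`, `s ⊗ (a ⊗ a′) ↦ F(a) F′(a′) s`.
[cite: Tate1997FiniteFlatGroupSchemes, §(3.8) p. 145] -/
def contractTwo (S : Type u) [CommRing S] [Algebra R S] (F F' : Module.Dual R (Alg G)) : S ⊗[R] (Alg G ⊗[R] Alg G) →ₗ[R] S :=
  (TensorProduct.rid R S).toLinearMap ∘ₗ (LinearMap.mul' R R ∘ₗ TensorProduct.map F F').lTensor S

omit [GrpObj G] [IsCommMonObj G] [IsAffine G.left] [Module.Free R (Alg G)] [Module.Finite R (Alg G)] in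
/-- `c_{F,F′} (s ⊗ (a ⊗ a′)) = (F a · F′ a′) • s`. [cite: Tate1997FiniteFlatGroupSchemes, §(3.8) p. 145] -/
@[simp] theorem contractTwo_tmul (F F' : Module.Dual R (Alg G)) (s : S) (a a' : Alg G) :
    contractTwo G S F F' (s ⊗ₜ (a ⊗ₜ a')) = (F a * F' a') • s := by
  simp [contractTwo]

omit [IsCommMonObj G] [Module.Free R (Alg G)] [Module.Finite R (Alg G)] in
/-- **`Φ z (F ⋆ F′) = c_{F,F′} (θ₁₂ z)`** — pairing with a CONVOLUTION of functionals is contraction of `(1 ⊗ Δ) z`.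
[cite: Tate1997FiniteFlatGroupSchemes, §(3.8) p. 145] -/
theorem charPairing_convMul (z : S ⊗[R] Alg G) (F F' : WithConv (Module.Dual R (Alg G))) :
    charPairing S G z (F * F').ofConv = contractTwo G S F.ofConv F'.ofConv (testMapMul G S z) := by
  induction z using TensorProduct.induction_on with
  | zero => rw [map_zero, LinearMap.zero_apply, map_zero, map_zero]
  | add z w hz hw => rw [map_add, LinearMap.add_apply, hz, hw, map_add, map_add]
  | tmul s a =>
    let 𝓡 := Coalgebra.Repr.arbitrary R a
    rw [charPairing_tmul, testMapMul_tmul, 𝓡.convMul_apply, ← 𝓡.eq, TensorProduct.tmul_sum, map_sum, Finset.sum_smul]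
    refine Finset.sum_congr rfl fun i _ => ?_
    rw [contractTwo_tmul]

omit [GrpObj G] [IsCommMonObj G] [IsAffine G.left] [Module.Free R (Alg G)] [Module.Finite R (Alg G)] in
/-- **`Φ z F · Φ w F′ = c_{F,F′} (θ₁ z · θ₂ w)`** — a product of pairing values is contraction of the product in `S ⊗ (A ⊗ A)` of the two
coordinate copies. [cite: Tate1997FiniteFlatGroupSchemes, §(3.8) p. 145] -/
theorem charPairing_mul_charPairing (z w : S ⊗[R] Alg G) (F F' : Module.Dual R (Alg G)) :
    charPairing S G z F * charPairing S G w F' = contractTwo G S F F' (testMapLeft G S z * testMapRight G S w) := by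
  induction z using TensorProduct.induction_on with
  | zero => rw [map_zero, LinearMap.zero_apply, zero_mul, map_zero, zero_mul, map_zero]
  | add z z' hz hz' => rw [map_add, LinearMap.add_apply, add_mul, hz, hz', map_add, add_mul, map_add]
  | tmul s a =>
    induction w using TensorProduct.induction_on with
    | zero => rw [map_zero, LinearMap.zero_apply, mul_zero, map_zero, mul_zero, map_zero]
    | add w w' hw hw' => rw [map_add, LinearMap.add_apply, mul_add, hw, hw', map_add, mul_add, map_add]
    | tmul s' a' =>
      rw [charPairing_tmul, charPairing_tmul, testMapLeft_tmul, testMapRight_tmul, Algebra.TensorProduct.tmul_mul_tmul,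
        Algebra.TensorProduct.tmul_mul_tmul, mul_one, one_mul, contractTwo_tmul, smul_mul_smul_comm]

/-- **EXISTENCE (over a fixed test ring `S`, test rings restricted to a class `P`)** — [Tate1997] §(3.8) «`G^D(S) = Hom_{S-gr}(G_S, 𝔾_{m,S})`»:
a family `χ_ψ(x) ∈ T` indexed by `R`-algebra maps `ψ : S → T` into test rings `T` of the class `P` and points `x ∈ G(T)`, which is
NATURAL (`χ_{θ∘ψ}(Spec θ ≫ x) = θ(χ_ψ(x))`), MULTIPLICATIVE (`χ_ψ(x₁ x₂) = χ_ψ(x₁) χ_ψ(x₂)`) and UNITAL (`χ_ψ(1) = 1`), IS the pairing with a point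
`t ∈ G^D(S)`: `⟪Spec ψ ≫ t, x⟫ = χ_ψ(x)` for all `T ∈ P`.  The class `P` must contain `S`, `S ⊗ A` and `S ⊗ (A ⊗ A)` (`A = Γ(G, 𝒪_G)`), the
only test rings the proof evaluates `χ` on (so `P :=` «finite `R`-algebras» works when `S` and `A` are finite — see `…_of_finite`; `P := ⊤`
is `exists_point_cartierDual_of_character`).  Construction: `g := χ_{ι}(x_univ) ∈ S ⊗ A` (`ι : S → S ⊗ A`, `x_univ` the tautological point);
`g` is GROUP-LIKE — multiplicativity on the universal pair of points over `S ⊗ (A ⊗ A)` gives `(1 ⊗ Δ) g = θ₁(g) θ₂(g)` hence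
`Φ g (F ⋆ F′) = Φ g F · Φ g F′` for all functionals (★ CD2-pts `isGroupLikeElem_of_map_convMul`), unitality gives `ε_S(g) = 1` —; `t :=` the
point of `g` (★ `cartierDualPointsMulEquivGroupLike`); the pairing formula is naturality along `ψ ⊗ x^* : S ⊗ A → T` (★
`cartierPairing_specOverMap_comp`). [cite: Tate1997FiniteFlatGroupSchemes, §(3.8) p. 145] [cite: Montgomery1993Hopf, 1.3.5, 9.1.4] -/
theorem exists_point_cartierDual_of_character_of (P : ∀ (T : Type u) [CommRing T] [Algebra R T], Prop)
    (hS : P S) (hSA : P (S ⊗[R] Alg G)) (hSAA : P (S ⊗[R] (Alg G ⊗[R] Alg G)))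
    (χ : ∀ ⦃T : Type u⦄ [CommRing T] [Algebra R T], (S →ₐ[R] T) → (specOver R T ⟶ G) → T)
    (hnat : ∀ ⦃T : Type u⦄ [CommRing T] [Algebra R T] ⦃T' : Type u⦄ [CommRing T'] [Algebra R T'], P T → P T' →
      ∀ (ψ : S →ₐ[R] T) (θ : T →ₐ[R] T') (x : specOver R T ⟶ G), χ (θ.comp ψ) (AlgPoints.specOverMapOfAlgHom θ ≫ x) = θ (χ ψ x))
    (hmul : ∀ ⦃T : Type u⦄ [CommRing T] [Algebra R T], P T → ∀ (ψ : S →ₐ[R] T) (x₁ x₂ : specOver R T ⟶ G), χ ψ (x₁ * x₂) = χ ψ x₁ * χ ψ x₂)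
    (hone : ∀ ⦃T : Type u⦄ [CommRing T] [Algebra R T], P T → ∀ (ψ : S →ₐ[R] T), χ ψ 1 = 1) :
    ∃ t : specOver R S ⟶ cartierDual G, ∀ ⦃T : Type u⦄ [CommRing T] [Algebra R T], P T →
      ∀ (ψ : S →ₐ[R] T) (x : specOver R T ⟶ G), cartierPairing G (AlgPoints.specOverMapOfAlgHom ψ ≫ t) x = χ ψ x := by
  -- the candidate group-like element
  let incl : S →ₐ[R] S ⊗[R] Alg G := Algebra.TensorProduct.includeLeft
  let g : S ⊗[R] Alg G := χ incl (tautPt G S)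
  -- naturality from the tautological point: `χ_{θ ∘ incl}(Spec θ ≫ x_univ) = θ g`
  have hg_nat : ∀ ⦃T' : Type u⦄ [CommRing T'] [Algebra R T'], P T' → ∀ (θ : S ⊗[R] Alg G →ₐ[R] T'),
      χ (θ.comp incl) (AlgPoints.specOverMapOfAlgHom θ ≫ tautPt G S) = θ g := fun T' _ _ hT' θ => hnat hSA hT' incl θ (tautPt G S)
  -- (i) the counit: `ε_S g = χ_{id}(1) = 1`
  have h_counit : Coalgebra.counit (R := S) g = 1 := by
    have h := hg_nat hS ((evalAt G (1 : specOver R S ⟶ G)).restrictScalars R)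
    rw [specOverMap_evalAt_one_comp_tautPt, evalAt_one_comp_includeLeft, hone hS, AlgHom.restrictScalars_apply, evalAt_one_eq_counit] at h
    exact h.symm
  -- (ii) the comultiplication: `(1 ⊗ Δ) g = θ₁ g · θ₂ g` from multiplicativity on the universal pair over `S ⊗ (A ⊗ A)`
  have h_comul : testMapMul G S g = testMapLeft G S g * testMapRight G S g := by
    have h₁ := hg_nat hSAA (testMapLeft G S)
    have h₂ := hg_nat hSAA (testMapRight G S)
    have h₁₂ := hg_nat hSAA (testMapMul G S)
    rw [testMapLeft_comp_includeLeft] at h₁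
    rw [testMapRight_comp_includeLeft] at h₂
    rw [testMapMul_comp_includeLeft, ← specOverMap_testMapLeft_mul_specOverMap_testMapRight, hmul hSAA, h₁, h₂] at h₁₂
    exact h₁₂.symm
  -- hence `g` is group-like
  have hg : IsGroupLikeElem S g := by
    refine isGroupLikeElem_of_map_convMul (Module.Free.chooseBasis R (Alg G)) (charPairing S G) (charPairing_tmul S G) ?_ fun F F' => ?_
    · have hε : (Algebra.linearMap R R ∘ₗ Coalgebra.counit : Module.Dual R (Alg G)) = Coalgebra.counit :=
        LinearMap.ext fun a => by simp
      rw [LinearMap.convOne_def, ofConv_toConv, hε, charPairing_counit, h_counit]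
    · rw [charPairing_convMul, h_comul, ← charPairing_mul_charPairing]
  -- the point and its pairing formula
  refine ⟨(cartierDualPointsMulEquivGroupLike S G).symm ⟨g, hg⟩, fun T _ _ hT ψ x => ?_⟩
  rw [cartierPairing_specOverMap_comp, MulEquiv.apply_symm_apply]
  -- `χ_ψ(x) = (ψ ⊗ x^*)(g)` by naturality along `ψ ⊗ x^* : S ⊗ A → T`
  let θ : S ⊗[R] Alg G →ₐ[R] T := Algebra.TensorProduct.lift ψ (ptEquiv G T x) fun _ _ => .all _ _
  have hθι : θ.comp incl = ψ := Algebra.TensorProduct.lift_comp_includeLeft _ _ _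
  have hθx : AlgPoints.specOverMapOfAlgHom θ ≫ tautPt G S = x := by
    apply (ptEquiv G T).injective
    rw [ptEquiv_comap, ptEquiv_tautPt]
    exact Algebra.TensorProduct.lift_comp_includeRight' _ _ _
  have h := hg_nat hT θ
  rw [hθι, hθx] at h
  exact h.symm

/-- **UNIQUENESS (fixed test ring)**: two points of `G^D(S)` with the same pairing values on the class `P ∋ S ⊗ A` are equal (★
`eq_of_cartierPairing_tautPt_eq`). [cite: Tate1997FiniteFlatGroupSchemes, §(3.8) p. 145] -/
theorem point_cartierDual_ext_of (P : ∀ (T : Type u) [CommRing T] [Algebra R T], Prop) (hSA : P (S ⊗[R] Alg G))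
    {t₁ t₂ : specOver R S ⟶ cartierDual G}
    (h : ∀ ⦃T : Type u⦄ [CommRing T] [Algebra R T], P T → ∀ (ψ : S →ₐ[R] T) (x : specOver R T ⟶ G),
      cartierPairing G (AlgPoints.specOverMapOfAlgHom ψ ≫ t₁) x = cartierPairing G (AlgPoints.specOverMapOfAlgHom ψ ≫ t₂) x) :
    t₁ = t₂ :=
  eq_of_cartierPairing_tautPt_eq G (h hSA _ _)

end FixedRing

end AffineGroupScheme

end Literature.AlgebraicGeometry.GroupSchemes

end
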